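import Summits.Langlands.Langlands.Theorems.IrreducibilityBySelfDualityReciprocityUpToIrreducibilitySatakeHalfRegularSector
import Summits.Langlands.Langlands.Theorems.IrreducibilityBySelfDualityReciprocityUpToIrreducibilityWDUnramifiedUniqueness
import Summits.Langlands.Langlands.Theorems.PicardMuOrdinaryMuOrdinaryFamilyRTDictionary
import Literature.NumberTheory.Automorphic.CarayolCompatibilityOfLocalGlobalGLnProofs
import Literature.NumberTheory.Automorphic.HarishChandraFinitenessGL
import Literature.NumberTheory.Automorphic.LocalComponentBJExistsProofs
import Literature.NumberTheory.Automorphic.AdicCompletionResidueCard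
import Literature.NumberTheory.GaloisRepresentations.WeilDeligneOfGaloisUnramifiedProofs
import Literature.NumberTheory.GaloisRepresentations.WeilDeligneRepFrobSemisimpleProofs
import Literature.NumberTheory.GaloisRepresentations.DecompositionGroupOfCompletion
import Literature.NumberTheory.GaloisRepresentations.LocalGaloisGroupProofs
import Literature.NumberTheory.GaloisRepresentations.LocalGaloisGroupFrobeniusProofs
import Literature.NumberTheory.GaloisRepresentations.InertiaCharacter
import Literature.NumberTheory.GaloisRepresentations.UnramifiedDatum
import HarnessLib

/-!
# Stub N16-A of line `Sketch` (crux `ReciprocityUpToIrreducibility`, item stmt-Langlands-14328):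
# the REGULAR sector over totally real / CM fields, every rank `n ≥ 2`, every `Rec`, modulo lang.S27 —
# `Corresponds` at the UNRAMIFIED places away from `ℓ`

Support file (closes nothing; wave N16-A of continuation lead c10).

Let `K` be totally real or CM, `n ≥ 2`, and `π` a cuspidal automorphic representation datum of
`GL_n(𝔸_K)` which is `L`-algebraic (Buzzard–Gee Def. 3.1.1) with a REGULAR infinity type.  GRANTING the
route's node lang.S27 (`exists_galoisRep_of_regularAlgebraic`: Harris–Lan–Taylor–Thorne 2016 Thm. A /
Scholze / Varma — a HYPOTHESIS of the theorems below, never an axiom), for every prime `ℓ`, every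
`ι : ℚ̄_ℓ ≃+* ℂ` and EVERY reciprocity datum `Rec` there is `ρ : Γ_K → GL_n(ℚ̄_ℓ)` which is
Satake–Frobenius compatible with `π` at almost every finite place and, at EVERY finite place `v ∤ ℓ` at
which `π` is unramified, Satake–Frobenius compatible with `π` AND locally–globally compatible with `π`
(`LocalGlobalCompatibleAt Rec ι π ρ v`: Taylor's Conj. 7, `WD_v(ρ)^{F-ss} = rec_v(π_v)` through `ι`).

Proof.  c9's POINTWISE form of lang.S27 in the summit's `L`-normalisation
(`exists_galoisRep_of_isLAlgebraic_of_isRegular`, `…SatakeHalfRegularSector`) gives the Satake clause at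
every unramified `v ∤ ℓ`; the a.e. clause follows since `π` is unramified almost everywhere
(`hasSatakeParamAt_cofinite_holds`, Flath) and only finitely many places lie above `ℓ`
(`Ideal.finite_factors`).  The local–global clause at `v ∤ ℓ` is the `v ∤ ℓ` branch of c6's
`localGlobalCompatibleAt_of_satakeFrobCompatibleAt` (`…UnramifiedMatchingGLn`), which needs NO
`FontaineDatumExists`: a local component `π_v` (`exists_hasLocalComponentAt_of_isAdmissible`), a
transport `rℂ` of `(ρ|_{W_{K_v}}, N = 0)` along `ι`, whose geometric Frobenii have characteristic
polynomial `∏_{a ∈ α} (X - a)`, hence `rℂ^{F-ss} ∈ rec_v(π_v)` (Carayol's deduction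
`LocalLanglandsDatum.recGL_unramified_of_hasSatakeParamAt` for EVERY local Langlands datum, plus the
uniqueness stub H1 `stub_wdUnramified_isEquivalent_of_charpoly_eq`), and the Grothendieck–Deligne recipe
at an unramified `ρ` (`IsWeilDeligneOfLadic.of_N_eq_zero`, with a non-trivial `ℚ̄_ℓ`-valued character of
inertia, `WeilGroup.exists_inertiaCharacter_ne_one_top`).  The accepted homes of these steps
(`…AboveUnramified.exists_isTransportAlong`, `…AwayUnramified.localGlobalCompatibleAt_away_of_isUnramifiedAt`,
`…TransportFrobCharpoly.transport_frobCharpoly`, `…UnramifiedMatching.hasFrobSemisimpleClass_of_unramified_charpoly`)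
all import `…TightnessAbove`, whose import chain runs through the route module
`Theses.IrreducibilityBySelfDuality`; they are re-derived here as private `_aux` copies (with
attribution) over Literature-level imports, as in `BaseFieldAscentReciprocityTRCMStubAutToGalCMtoTRCorresponds`.

* `localGlobalCompatibleAt_away_of_satakeFrobCompatibleAt` — `GL_n`, `n ≥ 2`, every `Rec`, `v ∤ ℓ`:
  Satake–Frobenius compatibility at `v` implies `LocalGlobalCompatibleAt Rec ι π ρ v`, with NO named fact;
* `regularSector_corresponds_away_unramified` — the sector theorem (implicit binders);
* `stub_regularSector_corresponds_away_unramified` — the closed form registered in the skeleton (N16-A).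

References: Harris–Lan–Taylor–Thorne, Res. Math. Sci. 3 (2016), Thm. A [HarrisLanTaylorThorneRMS2016];
Buzzard–Gee, LMS LNS 414 (2014), Conj. 3.2.1–3.2.2, Rem. 3.2.5, §5.3 [BuzzardGeeLMS2014]; Harris–Taylor,
Ann. of Math. Stud. 151 (2001), Thm. A [HarrisTaylorAMS2001]; Carayol, Ann. Sci. ÉNS 19 (1986), Thm. (A)
[CarayolASENS1986]; Tate, Corvallis 1979, (4.1.3)–(4.2.1) [TateCorvallis1979]; Deligne, Antwerp II, LNM 349
(1973), §8.4–8.6 [DeligneAntwerpII1973].  No definitions; standard axioms only; no named fact is assumed.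
-/

noncomputable section

set_option linter.dupNamespace false -- project-wide option (lakefile weak.linter.dupNamespace); `Summit.Langlands.Langlands` is the mandated namespace

open scoped NumberField Classical Polynomial MatrixGroups Matrix
open Filter IsDedekindDomain Field Polynomial
open Literature.NumberTheory.Automorphic Literature.NumberTheory.GaloisRepresentations
open Literature.NumberTheory.PAdicHodge
open Summit.Langlands

namespace Summit.Langlands.Langlands.Theorems.ReciprocityUpToIrreducibility

/-! ### Local Weil–Deligne bookkeeping on `Eⁿ` (private re-derivations) -/

section Local

variable {F : Type} [Field F] [ValuativeRel F] [TopologicalSpace F] [IsNonarchimedeanLocalField F]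
  {n : ℕ}

/-- The matrix of `ρ|_{W_F}(w)` (`FramedRep.weilRestrict`, `x ↦ ρ(w) *ᵥ x`) in the standard basis is
`ρ(w) = ρ.toWeilGroupHom w`. [cite: TateCorvallis1979, (1.4.1)] -/
private theorem toMatrix'_weilRestrict_aux {A : Type*} [CommRing A] [TopologicalSpace A]
    (ρ : FramedRep (absoluteGaloisGroup F) A n) (w : WeilGroup F) :
    LinearMap.toMatrix' (ρ.weilRestrict F w) =
      ((ρ.toWeilGroupHom w : GL (Fin n) A) : Matrix (Fin n) (Fin n) A) := by
  -- adapted from `…ReciprocityUpToIrreducibilityAwayUnramified.toMatrix'_weilRestrict` (c4)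
  have h : ρ.weilRestrict F w =
      Matrix.toLin' ((ρ.toWeilGroupHom w : GL (Fin n) A) : Matrix (Fin n) (Fin n) A) := by
    refine LinearMap.ext fun x => ?_
    rw [Matrix.toLin'_apply, FramedRep.weilRestrict_apply_apply, FramedRep.toWeilGroupHom_apply]
  rw [h, LinearMap.toMatrix'_toLin']

variable {E : Type*} [Field E] [CharZero E]

/-- **`(ρ|_{W_F}, 0)` is attached to a locally unramified `ρ` by the Grothendieck–Deligne recipe,
granted a character of `I_F` not identically `1`**: `U = I_F` (open), the given `t`, a geometric
Frobenius (`deg` is surjective), `N = 0` (`IsWeilDeligneOfLadic.of_N_eq_zero`).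
[cite: TateCorvallis1979, (4.1.3)–(4.2.1)] [cite: DeligneAntwerpII1973, §8.4.2] -/
private theorem isWeilDeligneOfLadic_ofRep_weilRestrict_aux [TopologicalSpace E]
    (ρ : FramedRep (absoluteGaloisGroup F) E n) (hρ : ρ.IsLocallyUnramified)
    (ht : ∃ t : WeilGroup.inertia F →* Multiplicative E, ∃ u : WeilGroup.inertia F, t u ≠ 1) :
    IsWeilDeligneOfLadic ρ.toWeilGroupHom
      (WeilDeligneRep.ofRep (ρ.weilRestrict F) hρ.isUnramifiedRep_weilRestrict.isContinuousRep) := by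
  -- adapted from `…ReciprocityUpToIrreducibilityAwayUnramified.isWeilDeligneOfLadic_ofRep_weilRestrict` (c4)
  obtain ⟨t, u, htu⟩ := ht
  obtain ⟨Φ, hΦ⟩ := WeilGroup.deg_surjective IsFrobPow.mul_holds IsFrobPow.unique_holds
    (exists_isFrobPow_holds F) (-1 : ℤ)
  refine IsWeilDeligneOfLadic.of_N_eq_zero ρ.toWeilGroupHom _ (WeilDeligneRep.ofRep_N _ _) t
    (WeilGroup.inertia F) le_rfl (WeilGroup.isOpen_inertia F) ⟨u, u.2, htu⟩ (fun w hw => ?_) Φ hΦ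
    fun m w => ?_
  · rw [FramedRep.toWeilGroupHom_apply]
    exact hρ _ (WeilGroup.mem_inertia_iff.mp hw)
  · rw [WeilDeligneRep.ofRep_ρ, toMatrix'_weilRestrict_aux]

variable {C : Type*} [Field C] [CharZero C]

/-- **Transport along `ι` exists**: for a Weil–Deligne representation `r = (ρ, N)` on `Eⁿ` and a ring
homomorphism `ι : E →+* C`, the pair `(ι ∘ ρ, ι N)` of entrywise images of matrices is a Weil–Deligne
representation on `Cⁿ` and a transport of `r` along `ι` (`WeilDeligneRep.IsTransportAlong`).
[cite: DeligneAntwerpII1973, §8.4.3] -/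
private theorem exists_isTransportAlong_aux (ι : E →+* C) (r : WeilDeligneRep F E (Fin n → E)) :
    ∃ r' : WeilDeligneRep F C (Fin n → C), r.IsTransportAlong ι r' := by
  -- adapted from `…ReciprocityUpToIrreducibilityAboveUnramified.exists_isTransportAlong` (c3)
  let Φ : Module.End E (Fin n → E) →+* Module.End C (Fin n → C) :=
    (Matrix.toLinAlgEquiv' : Matrix (Fin n) (Fin n) C ≃ₐ[C] _).toRingEquiv.toRingHom.comp
      ((ι.mapMatrix : Matrix (Fin n) (Fin n) E →+* Matrix (Fin n) (Fin n) C).comp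
        (LinearMap.toMatrixAlgEquiv' : Module.End E (Fin n → E) ≃ₐ[E] _).toRingEquiv.toRingHom)
  have hΦmat : ∀ f, LinearMap.toMatrix' (Φ f) = (LinearMap.toMatrix' f).map ι := fun f => by
    show LinearMap.toMatrixAlgEquiv'
      (Matrix.toLinAlgEquiv' (ι.mapMatrix (LinearMap.toMatrixAlgEquiv' f))) = _
    rw [LinearMap.toMatrixAlgEquiv'_toLinAlgEquiv', RingHom.mapMatrix_apply]
    rfl
  have hΦsmul : ∀ (c : E) (f : Module.End E (Fin n → E)), Φ (c • f) = ι c • Φ f := fun c f => by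
    refine LinearMap.toMatrix'.injective ?_
    rw [hΦmat, LinearEquiv.map_smul, LinearEquiv.map_smul, hΦmat]
    ext i j
    simp [Matrix.map_apply]
  refine ⟨{ ρ := Φ.toMonoidHom.comp r.ρ
            isContinuous := ?_
            N := Φ r.N
            isNilpotent_N := r.isNilpotent_N.map Φ
            conj_N := fun w => ?_ }, fun w => hΦmat _, hΦmat _⟩
  · obtain ⟨U, hU, hUo, hker⟩ := r.isContinuous
    refine ⟨U, hU, hUo, fun u hu => ?_⟩
    show Φ (r.ρ u) = 1
    rw [hker u hu, map_one]
  · show Φ (r.ρ w) ∘ₗ Φ r.N =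
      ((IsNonarchimedeanLocalField.residueFieldCard F : C) ^ WeilGroup.deg w) • (Φ r.N ∘ₗ Φ (r.ρ w))
    rw [← Module.End.mul_eq_comp, ← Module.End.mul_eq_comp, ← map_mul, ← map_mul,
      Module.End.mul_eq_comp, Module.End.mul_eq_comp, r.conj_N w, hΦsmul, map_zpow₀, map_natCast]

/-- **The formal matching on `ℂⁿ`.**  If `rℂ` has `N = 0`, is trivial on inertia, with geometric Frobenii
(`deg Φ = -1`) of characteristic polynomial `P`, and every representative of the Frobenius-semisimple class
`c` has the same three properties, then `rℂ^{F-ss} ∈ c` (`HasFrobSemisimpleClass`): the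
Frobenius-semisimplification (`WeilDeligneRep.exists_isFrobSemisimplificationOf`, Deligne 8.5; same `N`,
inertia and characteristic polynomials) and a representative of `c` satisfy the uniqueness stub H1
(`stub_wdUnramified_isEquivalent_of_charpoly_eq`). [cite: TateCorvallis1979, (4.1.3)–(4.1.6)]
[cite: DeligneAntwerpII1973, §8.5–8.6] -/
private theorem hasFrobSemisimpleClass_of_unramified_charpoly_aux (r : WeilDeligneRep F ℂ (Fin n → ℂ))
    (hN : r.N = 0) (hρ : WeilGroup.IsUnramifiedRep r.ρ) (P : ℂ[X])
    (hP : ∀ Φ : WeilGroup F, WeilGroup.deg Φ = -1 → (r.ρ Φ).charpoly = P)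
    (c : Quotient (frobSemisimpleWDSetoid F n))
    (hc : ∀ (A : WeilDeligneRep F ℂ (Fin n → ℂ)) (hA : A.IsFrobSemisimple),
      c = Quotient.mk (frobSemisimpleWDSetoid F n) ⟨A, hA⟩ →
        A.N = 0 ∧ WeilGroup.IsUnramifiedRep A.ρ ∧
          ∀ Φ : WeilGroup F, WeilGroup.deg Φ = -1 → (A.ρ Φ).charpoly = P) :
    r.HasFrobSemisimpleClass c := by
  -- adapted from `…ReciprocityUpToIrreducibilityUnramifiedMatching.hasFrobSemisimpleClass_of_unramified_charpoly` (c5)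
  obtain ⟨r', hr'⟩ := WeilDeligneRep.exists_isFrobSemisimplificationOf r
  have hN' : r'.N = 0 := hr'.1.trans hN
  have hρ' : WeilGroup.IsUnramifiedRep r'.ρ := fun u hu => (hr'.2.1 u hu).trans (hρ u hu)
  have hchar : ∀ w : WeilGroup F, (r'.ρ w).charpoly = (r.ρ w).charpoly := fun w => by
    obtain ⟨-, m, hm, hcm, hsum⟩ := hr'.2.2 w
    rw [hsum]
    exact (LinearMap.charpoly_add_eq_of_isNilpotent_of_commute hm hcm).symm
  obtain ⟨Φ, hΦ⟩ := WeilGroup.deg_surjective IsFrobPow.mul_holds IsFrobPow.unique_holds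
    (exists_isFrobPow_holds F) (-1 : ℤ)
  obtain ⟨⟨A, hA⟩, rfl⟩ := Quotient.exists_rep c
  obtain ⟨hAN, hAρ, hAchar⟩ := hc A hA rfl
  have he : r'.IsEquivalent A :=
    stub_wdUnramified_isEquivalent_of_charpoly_eq F n r' A Φ hΦ hN' hAN hρ' hAρ hr'.isFrobSemisimple hA
      (by rw [hchar Φ, hP Φ hΦ, hAchar Φ hΦ])
  exact ⟨r', hr', Quotient.sound he⟩

end Local

/-! ### The Galois side at an unramified place `v` of `K` (private re-derivations) -/

section Global

variable {K : Type} [Field K] [NumberField K] {ℓ : ℕ} [Fact ℓ.Prime] {n : ℕ}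

/-- **Unramified at `v` ⇒ `ρ|_{Γ_{K_v}}` kills the local inertia group `I_{K_v}`**
(`FramedGaloisRep.toLocal_eq_one_of_mem_absInertia`: `res (I_{K_v}) = I_{𝔓₀} ≤ Γ_K`, Neukirch II (9.6)).
[cite: NeukirchANT1999, Ch. II §9 Prop. (9.6)] [cite: SerreAbelianLadic1968, Ch. I §2.1] -/
private theorem isLocallyUnramified_toLocal_aux (ρ : FramedGaloisRep K (PadicAlgCl ℓ) n)
    (v : HeightOneSpectrum (𝓞 K)) (h : ρ.IsUnramifiedAt v) : (ρ.toLocal v).IsLocallyUnramified :=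
  -- same statement as `…ReciprocityUpToIrreducibilityWeakExistence.isLocallyUnramified_toLocal_of_isUnramifiedAt` (c1)
  fun _ hσ => ρ.toLocal_eq_one_of_mem_absInertia h hσ

/-- **Charpoly of a geometric Frobenius under an unramified `ρ|_{Γ_{K_v}}`**: if `ρ` is unramified at `v`
with arithmetic-Frobenius characteristic polynomial `∏_{a ∈ α} (X - ι⁻¹(a⁻¹))`, every `σ ∈ Γ_{K_v}` of
Frobenius degree `-1` has `char(ρ(σ)) = ∏_{a ∈ α} (X - ι⁻¹(a))` (`σ φ` is inertial for a local arithmetic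
Frobenius `φ`; `res φ` is an arithmetic Frobenius at the prime `𝔓₀` of the completion;
`char(M⁻¹) = ∏ (X - b⁻¹)`). [cite: TateCorvallis1979, (4.1.3)–(4.2.1)] [cite: SerreAbelianLadic1968, Ch. I §2.1] -/
private theorem charpoly_toLocal_of_isFrobPow_neg_one_aux (ι : PadicAlgCl ℓ ≃+* ℂ)
    (ρ : FramedGaloisRep K (PadicAlgCl ℓ) n) (v : HeightOneSpectrum (𝓞 K)) (hρ : ρ.IsUnramifiedAt v)
    (α : Multiset ℂ) (hfrob : ρ.HasFrobCharpolyAt v (arithFrobPolyOfSatake ι v.residueCard 1 α))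
    (σ : absoluteGaloisGroup (v.adicCompletion K)) (hσ : IsFrobPow σ (-1)) :
    (((ρ.toLocal v) σ : GL (Fin n) (PadicAlgCl ℓ)) : Matrix (Fin n) (Fin n) (PadicAlgCl ℓ)).charpoly =
      (α.map fun a => X - C (ι.symm a)).prod := by
  -- adapted from `…ReciprocityUpToIrreducibilityTransportFrobCharpoly.charpoly_toLocal_of_isFrobPow_neg_one` (c5)
  classical
  -- a local arithmetic Frobenius `φ`; `σ φ` is inertial, hence killed by `ρ|_{Γ_{K_v}}`
  obtain ⟨φ, hφ⟩ := exists_isAbsArithFrob_holds (v.adicCompletion K)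
  have h1 : IsFrobPow φ 1 := IsAbsArithFrob.isFrobPow_holds hφ
  have hin : σ * φ ∈ absInertia (v.adicCompletion K) := by
    simpa using IsFrobPow.mul_inv_mem_absInertia_holds hσ h1.inv
  have hker : ρ.toLocal v (σ * φ) = 1 := isLocallyUnramified_toLocal_aux ρ v hρ _ hin
  have hσeq : ρ.toLocal v σ = (ρ.toLocal v φ)⁻¹ :=
    eq_inv_of_mul_eq_one_left (by rwa [map_mul] at hker)
  -- the restriction of `φ` is an arithmetic Frobenius at `𝔓₀`, so `charpoly ρ(φ) = ∏ (X - ι⁻¹(a⁻¹))`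
  have hqN : IsNonarchimedeanLocalField.residueFieldCard (v.adicCompletion K) =
      Nat.card (𝓞 K ⧸ v.asIdeal) :=
    (residueFieldCard_adicCompletion_eq K v).trans (HeightOneSpectrum.residueCard_eq_card_quotient v)
  have hF : IsArithFrobAt (𝓞 K) (absGaloisRestrict K (v.adicCompletion K) φ)
      (adicCompletionPrime K v) :=
    (isArithFrobAt_absGaloisRestrict_adicCompletionPrime_iff K v hqN φ).mpr hφ
  have hM : (((ρ.toLocal v φ : GL (Fin n) (PadicAlgCl ℓ))) :
      Matrix (Fin n) (Fin n) (PadicAlgCl ℓ)).charpoly =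
        ((α.map fun a => ι.symm a⁻¹).map fun b => X - C b).prod := by
    rw [Multiset.map_map]
    have h := hfrob _ (adicCompletionPrime_mem_primesAbove K v) _ hF
    rw [arithFrobPolyOfSatake_one] at h
    exact h
  rw [hσeq, Matrix.coe_units_inv,
    Summit.Langlands.Langlands.Cruxes.MuOrdinaryFamilyRT.CharZeroDominance.charpoly_inv_of_charpoly_eq_prod
      (Units.isUnit _) hM, Multiset.map_map]
  refine congrArg _ (Multiset.map_congr rfl fun a _ => ?_)
  simp only [Function.comp_apply, map_inv₀, inv_inv]

/-- **Rank `n`, Galois side of the unramified matching**: for `ρ` unramified at `v` with the Satake clause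
`char(ρ(Frob_v^{arith})) = arithFrobPolyOfSatake ι q_v 1 α`, every transport `rℂ` of `(ρ|_{W_{K_v}}, 0)`
along `ι` has `N = 0`, is trivial on inertia, and its geometric Frobenii have `char = ∏_{a ∈ α} (X - a)`
(the transport is entrywise `ι`, `Matrix.charpoly_map`). [cite: TateCorvallis1979, (4.1.3)–(4.2.1)]
[cite: BuzzardGeeLMS2014, Rem. 3.2.5] -/
private theorem transport_frobCharpoly_aux (ι : PadicAlgCl ℓ ≃+* ℂ) (ρ : FramedGaloisRep K (PadicAlgCl ℓ) n)
    (v : HeightOneSpectrum (𝓞 K)) (hρ : ρ.IsUnramifiedAt v) (α : Multiset ℂ)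
    (hfrob : ρ.HasFrobCharpolyAt v (arithFrobPolyOfSatake ι v.residueCard 1 α))
    (rℂ : WeilDeligneRep (v.adicCompletion K) ℂ (Fin n → ℂ))
    (htr : (WeilDeligneRep.ofRep ((ρ.toLocal v).weilRestrict (v.adicCompletion K))
      (isLocallyUnramified_toLocal_aux ρ v hρ).isUnramifiedRep_weilRestrict.isContinuousRep).IsTransportAlong
        (ι : PadicAlgCl ℓ →+* ℂ) rℂ) :
    rℂ.N = 0 ∧ WeilGroup.IsUnramifiedRep rℂ.ρ ∧
      ∀ Φ : WeilGroup (v.adicCompletion K), WeilGroup.deg Φ = -1 →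
        (rℂ.ρ Φ).charpoly = (α.map fun a => X - C a).prod := by
  -- adapted from `…ReciprocityUpToIrreducibilityTransportFrobCharpoly.transport_frobCharpoly` (c5, stub H2)
  refine ⟨htr.N_eq_zero (WeilDeligneRep.ofRep_N _ _),
    htr.isUnramifiedRep (isLocallyUnramified_toLocal_aux ρ v hρ).isUnramifiedRep_weilRestrict,
    fun Φ hΦ => ?_⟩
  have hdeg : IsFrobPow (WeilGroup.toAbsGalois (v.adicCompletion K) Φ) (-1) := by
    simpa [hΦ] using WeilGroup.isFrobPow_deg IsFrobPow.mul_holds Φ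
  have hch := charpoly_toLocal_of_isFrobPow_neg_one_aux ι ρ v hρ α hfrob
    (WeilGroup.toAbsGalois (v.adicCompletion K) Φ) hdeg
  -- the matrix of `rℂ.ρ Φ` is the `ι`-image of that of `ρ(Φ)`
  have hmat := htr.1 Φ
  rw [WeilDeligneRep.ofRep_ρ, toMatrix'_weilRestrict_aux, FramedRep.toWeilGroupHom_apply] at hmat
  rw [charpoly_eq_charpoly_toMatrix', hmat, Matrix.charpoly_map, hch, Polynomial.map_multiset_prod,
    Multiset.map_map]
  refine congrArg _ (Multiset.map_congr rfl fun a _ => ?_)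
  simp only [Function.comp_apply, Polynomial.map_sub, Polynomial.map_X, Polynomial.map_C,
    RingHom.coe_coe, RingEquiv.apply_symm_apply]

/-! ### The `v ∤ ℓ` branch of the rank-`n` unramified matching, with NO named fact -/

/-- **`GL_n`, `2 ≤ n`, EVERY reciprocity datum, `v ∤ ℓ`: Satake–Frobenius compatibility at `v` implies
the summit's local–global clause at `v`, with NO named fact** — the `v ∤ ℓ` branch of c6's
`localGlobalCompatibleAt_of_satakeFrobCompatibleAt`: a local component `π_v` (Harish-Chandra admissibility,
`exists_hasLocalComponentAt_of_isAdmissible`), a transport `rℂ` of `(ρ|_{W_{K_v}}, 0)` along `ι` whose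
geometric Frobenii have characteristic polynomial `∏_{a ∈ α} (X - a)` (Galois side), `rℂ^{F-ss} ∈ rec_v(π_v)`
because every Frobenius-semisimple representative of `rec_v(π_v)` is unramified with the same polynomial
(Carayol's deduction for EVERY local Langlands datum, `LocalLanglandsDatum.recGL_unramified_of_hasSatakeParamAt`),
and the Grothendieck–Deligne recipe at an unramified `ρ` with a non-trivial `ℚ̄_ℓ`-valued character of
inertia (`WeilGroup.exists_inertiaCharacter_ne_one_top`); `FontaineDatumExists` (c6, `v ∣ ℓ` only) does
not enter. [cite: BuzzardGeeLMS2014, Conj. 3.2.1–3.2.2] [cite: HarrisTaylorAMS2001, Thm. A (ii), (v)]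
[cite: CarayolASENS1986, Thm. (A)] [cite: TateCorvallis1979, (4.1.3)–(4.2.1)] -/
theorem localGlobalCompatibleAt_away_of_satakeFrobCompatibleAt (hn : 1 < n)
    {hcpt : isCompact_glFiniteIntegralLevel n K} (Rec : ReciprocityData K) (ι : PadicAlgCl ℓ ≃+* ℂ)
    (π : CuspidalAutomorphicRepData n K hcpt) (ρ : FramedGaloisRep K (PadicAlgCl ℓ) n)
    {v : HeightOneSpectrum (𝓞 K)} (hv : ((ℓ : ℕ) : 𝓞 K) ∉ v.asIdeal)
    (hsat : SatakeFrobCompatibleAt ι π.1 ρ v) :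
    LocalGlobalCompatibleAt Rec ι π.1 ρ v := by
  -- adapted from c6's `localGlobalCompatibleAt_of_satakeFrobCompatibleAt` (the `v ∤ ℓ` branch)
  obtain ⟨α, hα, hρ, hcp⟩ := hsat
  obtain ⟨πv, hloc⟩ := AutomorphicRepData.exists_hasLocalComponentAt_of_isAdmissible
    (automorphicRep_isAdmissible_holds hcpt) π.1 v
  obtain ⟨rℂ, htr⟩ := exists_isTransportAlong_aux (ι : PadicAlgCl ℓ →+* ℂ)
    (WeilDeligneRep.ofRep ((ρ.toLocal v).weilRestrict (v.adicCompletion K))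
      (isLocallyUnramified_toLocal_aux ρ v hρ).isUnramifiedRep_weilRestrict.isContinuousRep)
  obtain ⟨hN, hunr, hchar⟩ := transport_frobCharpoly_aux ι ρ v hρ α hcp rℂ htr
  have hcls : rℂ.HasFrobSemisimpleClass ((Rec.llc v).recGL n (IrrClass.mk πv)) :=
    hasFrobSemisimpleClass_of_unramified_charpoly_aux rℂ hN hunr _ hchar _ fun A hA hAc =>
      (Rec.llc v).recGL_unramified_of_hasSatakeParamAt hn hcpt π v α hα πv hloc A hA hAc
  -- `r = (ρ|_{W_{K_v}}, 0)` is attached to `ρ|_{W_{K_v}}` by the Grothendieck–Deligne recipe (c4's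
  -- `localGlobalCompatibleAt_away_of_isUnramifiedAt`); the `v ∣ ℓ` clause is vacuous
  exact ⟨πv, _, rℂ, hloc, fun _ => isWeilDeligneOfLadic_ofRep_weilRestrict_aux (ρ.toLocal v)
      (isLocallyUnramified_toLocal_aux ρ v hρ)
      (WeilGroup.exists_inertiaCharacter_ne_one_top (F := v.adicCompletion K) (PadicAlgCl ℓ)),
    fun hv' => absurd hv' hv, htr, hcls⟩

/-! ### The regular sector at the unramified places away from `ℓ` -/

/-- **The regular sector over a totally real or CM field, every rank `n ≥ 2`, every `Rec`, modulo
lang.S27: `Corresponds` at the unramified places away from `ℓ`.**  Granting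
`exists_galoisRep_of_regularAlgebraic` (HLTT Thm. A / Scholze / Varma), an `L`-algebraic cuspidal `π` of
`GL_n(𝔸_K)` with a regular infinity type has, for all `ℓ`, `ι`, some `ρ : Γ_K → GL_n(ℚ̄_ℓ)` which is
Satake–Frobenius compatible with `π` at almost every place and, at EVERY place `v ∤ ℓ` where `π` is
unramified, Satake–Frobenius compatible AND locally–globally compatible with `π`: the pointwise Satake
data of `exists_galoisRep_of_isLAlgebraic_of_isRegular` (c9, Buzzard–Gee's half twist §5.3 applied to
lang.S27) at every unramified `v ∤ ℓ`; almost every place is such (`hasSatakeParamAt_cofinite_holds`,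
`Ideal.finite_factors`); and `localGlobalCompatibleAt_away_of_satakeFrobCompatibleAt`.
[cite: HarrisLanTaylorThorneRMS2016, Thm. A] [cite: BuzzardGeeLMS2014, Conj. 3.2.1–3.2.2 and §5.3]
[cite: HarrisTaylorAMS2001, Thm. A (ii), (v)] -/
theorem regularSector_corresponds_away_unramified (h27 : exists_galoisRep_of_regularAlgebraic)
    (hcpt : isCompact_glFiniteIntegralLevel n K) (hn : 1 < n)
    (hK : NumberField.IsTotallyReal K ∨ NumberField.IsCMField K) (Rec : ReciprocityData K)
    (π : CuspidalAutomorphicRepData n K hcpt) (hL : π.1.IsLAlgebraic)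
    (hreg : ∃ T : InfinityType K n, π.1.HasInfinityType T ∧ T.IsRegular)
    (ℓ : ℕ) [Fact ℓ.Prime] (ι : PadicAlgCl ℓ ≃+* ℂ) :
    ∃ ρ : FramedGaloisRep K (PadicAlgCl ℓ) n,
      (∀ᶠ v : HeightOneSpectrum (𝓞 K) in cofinite, SatakeFrobCompatibleAt ι π.1 ρ v) ∧
      ∀ v : HeightOneSpectrum (𝓞 K), ((ℓ : ℕ) : 𝓞 K) ∉ v.asIdeal → π.1.IsUnramifiedAt v →
        SatakeFrobCompatibleAt ι π.1 ρ v ∧ LocalGlobalCompatibleAt Rec ι π.1 ρ v := by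
  obtain ⟨r, -, hr⟩ :=
    exists_galoisRep_of_isLAlgebraic_of_isRegular h27 hcpt (lt_trans zero_lt_one hn) hK π hL hreg ℓ ι
  -- the pointwise Satake clause at every unramified place away from `ℓ`
  have hpt : ∀ v : HeightOneSpectrum (𝓞 K), ((ℓ : ℕ) : 𝓞 K) ∉ v.asIdeal → π.1.IsUnramifiedAt v →
      SatakeFrobCompatibleAt ι π.1 r v := fun v hvℓ hv => by
    obtain ⟨α, hα⟩ := hv
    exact ⟨α, hα, hr v α hα hvℓ⟩
  -- the finitely many places above `ℓ`
  have hℓ0 : Ideal.span {((ℓ : ℕ) : 𝓞 K)} ≠ ⊥ := by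
    rw [Ne, Ideal.span_singleton_eq_bot]
    exact_mod_cast (Fact.out : ℓ.Prime).ne_zero
  have hfin : ∀ᶠ v : HeightOneSpectrum (𝓞 K) in cofinite, ((ℓ : ℕ) : 𝓞 K) ∉ v.asIdeal := by
    rw [Filter.eventually_cofinite]
    refine (Ideal.finite_factors hℓ0).subset fun v hv => ?_
    simp only [Set.mem_setOf_eq, not_not] at hv
    exact Ideal.dvd_span_singleton.mpr hv
  refine ⟨r, ?_, fun v hvℓ hv => ⟨hpt v hvℓ hv, ?_⟩⟩
  · -- `π` is unramified at almost every place (Flath)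
    filter_upwards [π.1.hasSatakeParamAt_cofinite_holds, hfin] with v hv hvℓ
    exact hpt v hvℓ hv
  · exact localGlobalCompatibleAt_away_of_satakeFrobCompatibleAt hn Rec ι π r hvℓ (hpt v hvℓ hv)

/-- **stub N16-A (the regular sector, every rank `n ≥ 2`, every `Rec`, modulo lang.S27 only)** — closed
form of `regularSector_corresponds_away_unramified` (all binders explicit), the shape registered in the
skeleton: granting `exists_galoisRep_of_regularAlgebraic` (HLTT 2016 Thm. A / Scholze / Varma), every
`L`-algebraic cuspidal `π` of `GL_n(𝔸_K)`, `n ≥ 2`, `K` totally real or CM, with a regular infinity type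
has for all `ℓ, ι` some `ρ` Satake–Frobenius compatible with `π` a.e. AND, at EVERY place `v ∤ ℓ` where `π`
is unramified, Satake–Frobenius compatible and locally–globally compatible with `π`, for every `Rec`.
[cite: HarrisLanTaylorThorneRMS2016, Thm. A] [cite: BuzzardGeeLMS2014, Conj. 3.2.1–3.2.2 and §5.3]
[cite: HarrisTaylorAMS2001, Thm. A (ii), (v)] -/
theorem stub_regularSector_corresponds_away_unramified :
    exists_galoisRep_of_regularAlgebraic →
    ∀ (K : Type) [Field K] [NumberField K] (n : ℕ) (hcpt : isCompact_glFiniteIntegralLevel n K),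
      1 < n → (NumberField.IsTotallyReal K ∨ NumberField.IsCMField K) →
      ∀ (Rec : ReciprocityData K) (π : CuspidalAutomorphicRepData n K hcpt), π.1.IsLAlgebraic →
      (∃ T : InfinityType K n, π.1.HasInfinityType T ∧ T.IsRegular) →
      ∀ (ℓ : ℕ) [Fact ℓ.Prime] (ι : PadicAlgCl ℓ ≃+* ℂ),
        ∃ ρ : FramedGaloisRep K (PadicAlgCl ℓ) n,
          (∀ᶠ v : HeightOneSpectrum (𝓞 K) in cofinite, SatakeFrobCompatibleAt ι π.1 ρ v) ∧
          ∀ v : HeightOneSpectrum (𝓞 K), ((ℓ : ℕ) : 𝓞 K) ∉ v.asIdeal → π.1.IsUnramifiedAt v →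
            SatakeFrobCompatibleAt ι π.1 ρ v ∧ LocalGlobalCompatibleAt Rec ι π.1 ρ v := by
  intro h27 K _ _ n hcpt hn hK Rec π hL hreg ℓ _ ι
  exact regularSector_corresponds_away_unramified h27 hcpt hn hK Rec π hL hreg ℓ ι

end Global

end Summit.Langlands.Langlands.Theorems.ReciprocityUpToIrreducibility

end
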